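import Mathlib
import Literature.Combinatorics.SimpleGraph.LovaszTheta
import Literature.Combinatorics.SimpleGraph.HoffmanLovaszBound
import HarnessLib

/-!
# Knuth 1994, Lemmas 18 and 19: `ϑ` of a direct sum and of a direct cosum of graphs

Literature anchor (engines group, SDP-3 idle lane; shared numerical engines serving client
cells — rigour lives in the verifiers; every published number belongs to a client cell's
ledger, not to the engines group).  Topic `Literature/Combinatorics/SimpleGraph`, over the tree's
`lovaszTheta` (`LovaszTheta.lean`: `ϑ(G) = sup {Σ_{u,v} B_{uv} : B ⪰ 0, Tr B = 1, B_{uv} = 0 on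
E(G)}`, Lovász's Theorem 4 form) and Mathlib's disjoint sum of graphs `G ⊕g H`
(`SimpleGraph.sum`, on the vertex type `V ⊕ W`).

## What is printed

* D. E. Knuth, *The sandwich theorem*, Electron. J. Combin. **1** (1994) A1 [Knuth1994] (held,
  arXiv:math/9312214; read §18 "The direct sum of graphs", §19 "The direct cosum of graphs",
  §23 "Comments on the previous example", pp. 8 and 10).  §18: `G = G' + G''` on `V = V' ∪ V''`
  (disjoint), "`u ∼ v` in `G` if and only if `u, v ∈ V'` and `u ∼ v` in `G'`, or `u, v ∈ V''` and
  `u ∼ v` in `G''`"; **Lemma 18, (18.2)**: `ϑ(G, w) = ϑ(G', w') + ϑ(G'', w'')`.  §19: the cosum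
  **(19.1)** `G = G' ∓ G'' ⟺ Ḡ = Ḡ' + Ḡ''` ("`u ∼ v` in `G` if and only if either `u ∼ v` in
  `G'` or `u ∼ v` in `G''` or `u` and `v` belong to opposite vertex sets"); **Lemma 19, (19.2)**:
  `ϑ(G, w) = max(ϑ(G', w'), ϑ(G'', w''))`.  §23, **(23.1)**: "If `G = K̄_m + K_{n-m}` then
  `Ḡ = K_m ∓ K̄_{n-m}`, hence we know from Lemmas 18 and 19 that `ϑ(G) = m + 1`,
  `ϑ(Ḡ) = max(1, n - m)`.  In particular, we can make `ϑ(G)ϑ(Ḡ)` as high as `n²/4 + n/2`."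
* L. Lovász, *On the Shannon capacity of a graph*, IEEE Trans. Inform. Theory **25** (1979) 1–7
  [Lovasz1979]: Theorem 4 (the maximisation form used by the tree) and the sandwich
  `α(G) ≤ ϑ(G) ≤ χ(Ḡ)` (so `ϑ(K̄_n) = n`).

## What is here (all proved, no `sorry`, no new axioms; unit weights `w = 𝟙` throughout)

* `lovaszTheta_sum`: **`ϑ(G ⊕g H) = ϑ(G) + ϑ(H)`** (Lemma 18) for graphs on nonempty finite
  vertex types, from `lovaszTheta_sum_le` (every feasible `B` on `V ⊕ W` has
  `Σ B ≤ ϑ(G) + ϑ(H)`: its diagonal blocks are feasible up to the scalings `Tr B₁₁`, `Tr B₂₂`,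
  and the off-diagonal mass is controlled by Cauchy–Schwarz for the form `xᵀBx`) and
  `add_le_lovaszTheta_sum` (the explicit feasible block matrix `sumMatrix B₁ B₂ =
  (p₁+p₂)⁻¹ [[p₁B₁, r₁r₂ᵀ], [r₂r₁ᵀ, p₂B₂]]`, `rᵢ = Bᵢ𝟙`, `pᵢ = 𝟙ᵀBᵢ𝟙`, of value `p₁ + p₂` —
  the matrix form of Knuth's labeling (18.4)).
* `lovaszTheta_sum_compl`: **`ϑ((G ⊕g H)ᶜ) = max(ϑ(Gᶜ), ϑ(Hᶜ))`**, equivalently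
  `lovaszTheta_cosum`: **`ϑ((Gᶜ ⊕g Hᶜ)ᶜ) = max(ϑ(G), ϑ(H))`** (Lemma 19 with the cosum
  defined by (19.1)): a feasible matrix for the complement of a sum vanishes off the diagonal
  blocks, so its value is a convex combination of values for `Gᶜ` and `Hᶜ`; conversely a
  feasible matrix for `Gᶜ` padded with zeros is feasible for `(G ⊕g H)ᶜ`.
* `entrySum_le_trace_mul_lovaszTheta`: the homogeneity step `Σ P ≤ Tr P · ϑ(G)` for `P ⪰ 0`
  vanishing on `E(G)`; `lovaszTheta_bot`: `ϑ(K̄_n) = n`.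
* (23.1): `lovaszTheta_bot_sum_top` (`ϑ(K̄_{m+1} + K_{k+1}) = (m + 1) + 1`) and
  `lovaszTheta_bot_sum_top_compl` (`ϑ` of the complement `= k + 1 = max(1, k+1)`), with the
  instance `G = K̄₂ + K₂` (`n = 4`): `ϑ(G) ϑ(Ḡ) = 3 · 2 = 6 = n²/4 + n/2 > n`
  (`lovaszTheta_mul_compl_bot_sum_top_two`).

Proofs are carried out directly in the matrix (Theorem 4) formulation rather than with Knuth's
orthogonal labelings; the weighted versions (general `w`) are not formalised here.
-/

namespace Literature.Combinatorics.SimpleGraph.LovaszThetaDirectSum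

open Matrix Finset Literature.Combinatorics.SimpleGraph.HoffmanLovaszBound

variable {V W : Type*} [Fintype V] [Fintype W]

/-! ### Quadratic-form bookkeeping -/

/-- Cauchy–Schwarz for a positive semidefinite real form: `(uᵀBv)² ≤ (uᵀBu)(vᵀBv)`
(discriminant of `t ↦ (tu+v)ᵀB(tu+v) ≥ 0`). [folklore] -/
@[folklore] private theorem dotProduct_mulVec_sq_le {ι : Type*} [Fintype ι] {B : Matrix ι ι ℝ}
    (hB : B.PosSemidef) (u v : ι → ℝ) :
    (u ⬝ᵥ B *ᵥ v) ^ 2 ≤ (u ⬝ᵥ B *ᵥ u) * (v ⬝ᵥ B *ᵥ v) := by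
  have hsymm : Bᵀ = B := by
    have h := hB.1
    rwa [Matrix.IsHermitian, conjTranspose_eq_transpose_of_trivial] at h
  have hvu : v ⬝ᵥ B *ᵥ u = u ⬝ᵥ B *ᵥ v := by
    rw [dotProduct_mulVec, ← mulVec_transpose, hsymm, dotProduct_comm]
  have hq : ∀ t : ℝ, 0 ≤ (u ⬝ᵥ B *ᵥ u) * (t * t) + 2 * (u ⬝ᵥ B *ᵥ v) * t + v ⬝ᵥ B *ᵥ v := by
    intro t
    have h := hB.dotProduct_mulVec_nonneg (t • u + v)
    simp only [star_trivial, mulVec_add, mulVec_smul, add_dotProduct, dotProduct_add,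
      smul_dotProduct, dotProduct_smul, hvu, smul_eq_mul] at h
    have e : (u ⬝ᵥ B *ᵥ u) * (t * t) + 2 * (u ⬝ᵥ B *ᵥ v) * t + v ⬝ᵥ B *ᵥ v =
        t * (t * (u ⬝ᵥ B *ᵥ u) + u ⬝ᵥ B *ᵥ v) + (t * (u ⬝ᵥ B *ᵥ v) + v ⬝ᵥ B *ᵥ v) := by
      ring
    rw [e]
    exact h
  have hd := discrim_le_zero hq
  rw [discrim] at hd
  nlinarith [hd]

/-- A real positive semidefinite matrix is symmetric: `B v u = B u v`. [folklore] -/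
@[folklore] private theorem apply_comm {ι : Type*} {B : Matrix ι ι ℝ} (hB : B.PosSemidef)
    (u v : ι) : B v u = B u v := by
  have h := hB.1.apply u v
  rwa [star_trivial] at h

/-- `(cB)ᴴ = cB` for real symmetric `B`. [folklore] -/
@[folklore] private theorem isHermitian_smul {ι : Type*} {B : Matrix ι ι ℝ} (hB : B.IsHermitian)
    (c : ℝ) : (c • B).IsHermitian := by
  rw [IsHermitian, conjTranspose_smul, star_trivial, hB.eq]

/-- `Σ_{u,v} B_{uv} = 𝟙ᵀ B 𝟙`. [folklore] -/
@[folklore] private theorem entrySum_eq_one_dotProduct {ι : Type*} [Fintype ι]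
    (B : Matrix ι ι ℝ) : entrySum B = (1 : ι → ℝ) ⬝ᵥ B *ᵥ 1 := by
  simp [entrySum, dotProduct, mulVec]

/-- Row sums: `(B𝟙)_u = Σ_v B_{uv}`, so `Σ_u (B𝟙)_u = Σ_{u,v} B_{uv}`. [folklore] -/
@[folklore] private theorem sum_mulVec_one {ι : Type*} [Fintype ι] (B : Matrix ι ι ℝ) :
    ∑ u, (B *ᵥ 1) u = entrySum B := by
  simp [entrySum, mulVec, dotProduct]

/-- `Σ (cM) = c Σ M`. [folklore] -/
@[folklore] private theorem entrySum_smul {ι : Type*} [Fintype ι] (c : ℝ) (M : Matrix ι ι ℝ) :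
    entrySum (c • M) = c * entrySum M := by
  unfold entrySum
  simp only [Matrix.smul_apply, smul_eq_mul, Finset.mul_sum]

/-- `yᵀ (a bᵀ) z = (yᵀa)(zᵀb)`. [folklore] -/
@[folklore] private theorem dotProduct_vecMulVec_mulVec {ι κ : Type*} [Fintype ι] [Fintype κ]
    (y a : ι → ℝ) (b z : κ → ℝ) : y ⬝ᵥ (vecMulVec a b *ᵥ z) = (y ⬝ᵥ a) * (z ⬝ᵥ b) := by
  simp only [dotProduct]
  rw [Finset.sum_mul_sum]
  simp only [mulVec, dotProduct, vecMulVec_apply, Finset.mul_sum]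
  exact sum_congr rfl fun i _ => sum_congr rfl fun j _ => by ring

/-! ### Homogeneity: `Σ P ≤ Tr P · ϑ(G)` -/

/-- **Homogeneity of Lovász's programme**: if `P ⪰ 0` vanishes on the edges of `G` then
`Σ_{u,v} P_{uv} ≤ Tr P · ϑ(G)` (for `Tr P > 0`, `P / Tr P` is feasible; for `Tr P = 0`, `P ⪰ 0`
forces `Σ P ≤ |V| · Tr P = 0`).  This is the scaling of the sub-labelings in Knuth's §18–§19
(`‖a'_v‖² = ϑ'`, (18.3)). [cite: Knuth1994, §18 (18.3)–(18.6)] -/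
theorem entrySum_le_trace_mul_lovaszTheta [DecidableEq V] {G : SimpleGraph V} {P : Matrix V V ℝ}
    (hP : P.PosSemidef) (hE : ∀ ⦃u v : V⦄, G.Adj u v → P u v = 0) :
    entrySum P ≤ P.trace * lovaszTheta G := by
  rcases (hP.trace_nonneg).eq_or_lt with htr | htr
  · -- `Tr P = 0`: every entry is `≤ (P_uu + P_vv)/2`, so `Σ P ≤ |V| · Tr P = 0`
    have h1 : ∀ u v, P u v ≤ (P u u + P v v) / 2 := fun u v => by
      linarith [two_mul_apply_le hP u v]
    have hdiag : ∑ u, P u u = 0 := by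
      have := htr.symm
      rwa [Matrix.trace] at this
    have h2 : ∑ u, ∑ v, (P u u + P v v) / 2 = (Fintype.card V : ℝ) * ∑ u, P u u := by
      simp only [add_div, sum_add_distrib, sum_const, card_univ, nsmul_eq_mul]
      rw [mul_sum, mul_sum, ← sum_add_distrib]
      exact sum_congr rfl fun u _ => by ring
    calc entrySum P = ∑ u, ∑ v, P u v := rfl
      _ ≤ ∑ u, ∑ v, (P u u + P v v) / 2 := sum_le_sum fun u _ => sum_le_sum fun v _ => h1 u v
      _ = 0 := by rw [h2, hdiag, mul_zero]
      _ = P.trace * lovaszTheta G := by rw [← htr, zero_mul]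
  · -- `Tr P > 0`: `P / Tr P` is feasible
    have hfeas : IsThetaFeasible G (P.trace⁻¹ • P) :=
      { posSemidef := hP.smul (inv_nonneg.2 htr.le)
        trace_eq_one := by rw [trace_smul, smul_eq_mul, inv_mul_cancel₀ htr.ne']
        apply_eq_zero := fun u v huv => by simp [hE huv] }
    have h := le_csSup (bddAbove_thetaValues G) ⟨_, hfeas, rfl⟩
    change entrySum (P.trace⁻¹ • P) ≤ lovaszTheta G at h
    rw [entrySum_smul] at h
    calc entrySum P = P.trace * (P.trace⁻¹ * entrySum P) := by
          rw [← mul_assoc, mul_inv_cancel₀ htr.ne', one_mul]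
      _ ≤ P.trace * lovaszTheta G := mul_le_mul_of_nonneg_left h htr.le

/-- **`ϑ(K̄_n) = n`**: `≤` is `ϑ ≤ |V|`, `≥` is the clique bound applied to the `n`-clique `V` of
`K_n = (K̄_n)ᶜ` (Lovász's sandwich `α ≤ ϑ ≤ χ̄`). [cite: Lovasz1979, Theorem 4 and the bound
α(G) ≤ ϑ(G) (p. 3)] [cite: Knuth1994, §23 (23.1) (ϑ(K̄_m + K_{n-m}) = m + 1)] -/
theorem lovaszTheta_bot [DecidableEq V] [Nonempty V] :
    lovaszTheta (⊥ : SimpleGraph V) = Fintype.card V := by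
  refine le_antisymm (lovaszTheta_le_card _) ?_
  have hS : (⊤ : SimpleGraph V).IsNClique (Fintype.card V) univ :=
    ⟨fun u _ v _ huv => (SimpleGraph.top_adj u v).2 huv, card_univ⟩
  have h := le_lovaszTheta_compl_of_isNClique hS
  rwa [compl_top] at h

/-! ### The blocks of a matrix on `V ⊕ W` -/

section Blocks

variable (B : Matrix (V ⊕ W) (V ⊕ W) ℝ)

/-- The off-diagonal mass `c(B) = Σ_{u ∈ V, w ∈ W} B_{(inl u)(inr w)}`. [folklore] -/
@[folklore] private def crossSum : ℝ := ∑ u : V, ∑ w : W, B (Sum.inl u) (Sum.inr w)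

/-- `Σ B = Σ B₁₁ + Σ B₂₂ + Σ B₁₂ + Σ B₂₁` on `V ⊕ W`. [folklore] -/
@[folklore] private theorem entrySum_sum_eq :
    entrySum B = entrySum (B.submatrix Sum.inl Sum.inl) + entrySum (B.submatrix Sum.inr Sum.inr)
      + crossSum B + ∑ w : W, ∑ u : V, B (Sum.inr w) (Sum.inl u) := by
  simp only [entrySum, crossSum, submatrix_apply, Fintype.sum_sum_type, sum_add_distrib]
  ring

/-- `Tr B = Tr B₁₁ + Tr B₂₂` on `V ⊕ W`. [folklore] -/
@[folklore] private theorem trace_sum_eq :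
    B.trace = (B.submatrix Sum.inl Sum.inl).trace + (B.submatrix Sum.inr Sum.inr).trace := by
  simp only [Matrix.trace, Matrix.diag, submatrix_apply, Fintype.sum_sum_type]

/-- The quadratic form of `B` at the block indicator vectors: `𝟙_Vᵀ B 𝟙_V = Σ B₁₁`,
`𝟙_Wᵀ B 𝟙_W = Σ B₂₂`, `𝟙_Vᵀ B 𝟙_W = c(B)`. [folklore] -/
@[folklore] private theorem indicator_forms :
    (Sum.elim (1 : V → ℝ) (0 : W → ℝ)) ⬝ᵥ B *ᵥ (Sum.elim (1 : V → ℝ) (0 : W → ℝ)) =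
        entrySum (B.submatrix Sum.inl Sum.inl) ∧
      (Sum.elim (0 : V → ℝ) (1 : W → ℝ)) ⬝ᵥ B *ᵥ (Sum.elim (0 : V → ℝ) (1 : W → ℝ)) =
        entrySum (B.submatrix Sum.inr Sum.inr) ∧
      (Sum.elim (1 : V → ℝ) (0 : W → ℝ)) ⬝ᵥ B *ᵥ (Sum.elim (0 : V → ℝ) (1 : W → ℝ)) =
        crossSum B := by
  refine ⟨?_, ?_, ?_⟩ <;>
    simp [dotProduct, mulVec, entrySum, crossSum, Fintype.sum_sum_type]

variable (A : Matrix V V ℝ) (A' : Matrix V W ℝ) (C : Matrix W V ℝ) (D : Matrix W W ℝ)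

omit [Fintype V] [Fintype W] in
/-- The `V`-block of `[[A, A'], [C, D]]` is `A`. [folklore] -/
@[folklore] private theorem submatrix_fromBlocks_inl :
    (Matrix.fromBlocks A A' C D).submatrix Sum.inl Sum.inl = A := by
  ext; simp

omit [Fintype V] [Fintype W] in
/-- The `W`-block of `[[A, A'], [C, D]]` is `D`. [folklore] -/
@[folklore] private theorem submatrix_fromBlocks_inr :
    (Matrix.fromBlocks A A' C D).submatrix Sum.inr Sum.inr = D := by
  ext; simp

/-- The off-diagonal masses of `[[A, A'], [C, D]]` are `Σ A'` and `Σ C`. [folklore] -/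
@[folklore] private theorem crossSum_fromBlocks :
    crossSum (Matrix.fromBlocks A A' C D) = ∑ u, ∑ w, A' u w ∧
      ∑ w : W, ∑ u : V, (Matrix.fromBlocks A A' C D) (Sum.inr w) (Sum.inl u) = ∑ w, ∑ u, C w u := by
  constructor <;> simp [crossSum]

end Blocks

/-! ### Lemma 18, upper bound: `ϑ(G ⊕g H) ≤ ϑ(G) + ϑ(H)` -/

/-- The elementary inequality behind (18.2): if `p ≤ t s₁`, `0 ≤ q ≤ t' s₂`, `c² ≤ pq` with
`t, t', s₁, s₂ ≥ 0` and `t + t' = 1`, then `p + q + 2c ≤ s₁ + s₂`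
(`2c ≤ 2√(pq) ≤ 2√(t s₁ · t' s₂) ≤ t' s₁ + t s₂`). [folklore] -/
@[folklore] private theorem sum_bound_of_sq_le {p q c t t' s₁ s₂ : ℝ} (hq : 0 ≤ q) (ht : 0 ≤ t)
    (ht' : 0 ≤ t') (htt : t + t' = 1) (hs₁ : 0 ≤ s₁) (hs₂ : 0 ≤ s₂) (hps : p ≤ t * s₁)
    (hqs : q ≤ t' * s₂) (hc : c ^ 2 ≤ p * q) : p + q + 2 * c ≤ s₁ + s₂ := by
  have hR : 0 ≤ t' * s₁ + t * s₂ := add_nonneg (mul_nonneg ht' hs₁) (mul_nonneg ht hs₂)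
  have h2c : 2 * c ≤ t' * s₁ + t * s₂ := by
    rcases le_or_gt c 0 with hc0 | hc0
    · linarith
    · rw [← sq_le_sq₀ (by linarith) hR]
      have hpq : p * q ≤ (t * s₁) * (t' * s₂) := mul_le_mul hps hqs hq (mul_nonneg ht hs₁)
      nlinarith [sq_nonneg (t' * s₁ - t * s₂)]
  calc p + q + 2 * c ≤ t * s₁ + t' * s₂ + (t' * s₁ + t * s₂) := by linarith
    _ = (t + t') * (s₁ + s₂) := by ring
    _ = s₁ + s₂ := by rw [htt, one_mul]

/-- **Lemma 18, `≤`**: every feasible matrix `B` for `G ⊕g H` has `Σ B ≤ ϑ(G) + ϑ(H)`; hence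
`ϑ(G ⊕g H) ≤ ϑ(G) + ϑ(H)`.  The diagonal blocks `B₁₁`, `B₂₂` are positive semidefinite and vanish
on `E(G)`, `E(H)`, so `Σ B₁₁ ≤ Tr B₁₁ · ϑ(G)`, `Σ B₂₂ ≤ Tr B₂₂ · ϑ(H)`
(`entrySum_le_trace_mul_lovaszTheta`), `Tr B₁₁ + Tr B₂₂ = 1`, and the off-diagonal mass `c`
satisfies `c² ≤ Σ B₁₁ · Σ B₂₂` (Cauchy–Schwarz for `xᵀBx` at the block indicators).
[cite: Knuth1994, §18 Lemma (18.2)] -/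
theorem lovaszTheta_sum_le [DecidableEq V] [DecidableEq W] (G : SimpleGraph V)
    (H : SimpleGraph W) : lovaszTheta (G ⊕g H) ≤ lovaszTheta G + lovaszTheta H := by
  refine Real.sSup_le ?_ (add_nonneg (lovaszTheta_nonneg G) (lovaszTheta_nonneg H))
  rintro _ ⟨B, hB, rfl⟩
  set P := B.submatrix Sum.inl Sum.inl with hPdef
  set Q := B.submatrix Sum.inr Sum.inr with hQdef
  have hP : P.PosSemidef := hB.posSemidef.submatrix Sum.inl
  have hQ : Q.PosSemidef := hB.posSemidef.submatrix Sum.inr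
  have hPE : ∀ ⦃u v : V⦄, G.Adj u v → P u v = 0 := fun u v huv =>
    hB.apply_eq_zero (SimpleGraph.sum_adj_inl.2 huv)
  have hQE : ∀ ⦃u v : W⦄, H.Adj u v → Q u v = 0 := fun u v huv =>
    hB.apply_eq_zero (SimpleGraph.sum_adj_inr.2 huv)
  have hps := entrySum_le_trace_mul_lovaszTheta hP hPE
  have hqs := entrySum_le_trace_mul_lovaszTheta hQ hQE
  have htt : P.trace + Q.trace = 1 := by rw [← trace_sum_eq B, hB.trace_eq_one]
  obtain ⟨hxx, hyy, hxy⟩ := indicator_forms B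
  have hq0 : 0 ≤ entrySum Q := by
    rw [← hyy]
    have := hB.posSemidef.dotProduct_mulVec_nonneg (Sum.elim (0 : V → ℝ) (1 : W → ℝ))
    rwa [star_trivial] at this
  have hcs : crossSum B ^ 2 ≤ entrySum P * entrySum Q := by
    rw [← hxx, ← hyy, ← hxy]
    exact dotProduct_mulVec_sq_le hB.posSemidef _ _
  have hsymm : ∑ w : W, ∑ u : V, B (Sum.inr w) (Sum.inl u) = crossSum B := by
    rw [crossSum, sum_comm]
    exact sum_congr rfl fun u _ => sum_congr rfl fun w _ => apply_comm hB.posSemidef _ _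
  rw [entrySum_sum_eq B, hsymm, ← hPdef, ← hQdef, add_assoc, ← two_mul]
  exact sum_bound_of_sq_le hq0 hP.trace_nonneg hQ.trace_nonneg htt (lovaszTheta_nonneg G)
    (lovaszTheta_nonneg H) hps hqs hcs

/-! ### Lemma 18, lower bound: the block matrix `sumMatrix` -/

/-- The matrix form of Knuth's labeling (18.4): for `B₁` (on `V`) and `B₂` (on `W`) with row
sums `rᵢ = Bᵢ𝟙` and values `pᵢ = 𝟙ᵀBᵢ𝟙`, the block matrix
`(p₁ + p₂)⁻¹ · [[p₁ B₁, r₁ r₂ᵀ], [r₂ r₁ᵀ, p₂ B₂]]` on `V ⊕ W`.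
[cite: Knuth1994, §18 (18.4)–(18.7)] -/
noncomputable def sumMatrix (B₁ : Matrix V V ℝ) (B₂ : Matrix W W ℝ) :
    Matrix (V ⊕ W) (V ⊕ W) ℝ :=
  (entrySum B₁ + entrySum B₂)⁻¹ •
    Matrix.fromBlocks (entrySum B₁ • B₁) (vecMulVec (B₁ *ᵥ 1) (B₂ *ᵥ 1))
      (vecMulVec (B₂ *ᵥ 1) (B₁ *ᵥ 1)) (entrySum B₂ • B₂)

/-- The unnormalised block matrix `[[p₁ B₁, r₁ r₂ᵀ], [r₂ r₁ᵀ, p₂ B₂]]` is positive semidefinite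
when `B₁, B₂ ⪰ 0`: its form at `(y, z)` is `p₁ yᵀB₁y + 2 (yᵀr₁)(zᵀr₂) + p₂ zᵀB₂z ≥
(yᵀr₁)² + 2 (yᵀr₁)(zᵀr₂) + (zᵀr₂)² ≥ 0` by Cauchy–Schwarz `(yᵀBᵢ𝟙)² ≤ (yᵀBᵢy)(𝟙ᵀBᵢ𝟙)`.
[cite: Knuth1994, §18 (18.5)–(18.7)] -/
theorem posSemidef_fromBlocks {B₁ : Matrix V V ℝ} {B₂ : Matrix W W ℝ} (h₁ : B₁.PosSemidef)
    (h₂ : B₂.PosSemidef) :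
    (Matrix.fromBlocks (entrySum B₁ • B₁) (vecMulVec (B₁ *ᵥ 1) (B₂ *ᵥ 1))
      (vecMulVec (B₂ *ᵥ 1) (B₁ *ᵥ 1)) (entrySum B₂ • B₂)).PosSemidef := by
  refine PosSemidef.of_dotProduct_mulVec_nonneg ?_ fun x => ?_
  · refine IsHermitian.fromBlocks (isHermitian_smul h₁.1 _) ?_ (isHermitian_smul h₂.1 _)
    rw [conjTranspose_vecMulVec, star_trivial, star_trivial]
  · obtain ⟨y, z, rfl⟩ : ∃ (y : V → ℝ) (z : W → ℝ), x = Sum.elim y z :=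
      ⟨x ∘ Sum.inl, x ∘ Sum.inr, (Sum.elim_comp_inl_inr x).symm⟩
    have hcs₁ := dotProduct_mulVec_sq_le h₁ y 1
    have hcs₂ := dotProduct_mulVec_sq_le h₂ z 1
    rw [← entrySum_eq_one_dotProduct] at hcs₁ hcs₂
    have hy := h₁.dotProduct_mulVec_nonneg y
    have hz := h₂.dotProduct_mulVec_nonneg z
    rw [star_trivial] at hy hz ⊢
    rw [fromBlocks_mulVec, Sum.elim_comp_inl, Sum.elim_comp_inr, sumElim_dotProduct_sumElim,
      dotProduct_add, dotProduct_add, smul_mulVec, smul_mulVec, dotProduct_smul,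
      dotProduct_smul, dotProduct_vecMulVec_mulVec, dotProduct_vecMulVec_mulVec, smul_eq_mul,
      smul_eq_mul]
    nlinarith [hcs₁, hcs₂, sq_nonneg (y ⬝ᵥ B₁ *ᵥ 1 + z ⬝ᵥ B₂ *ᵥ 1), hy, hz]

/-- **`sumMatrix B₁ B₂` is feasible for `G ⊕g H`** when `B₁`, `B₂` are feasible for `G`, `H`
and `p₁ + p₂ > 0`: positive semidefinite (`posSemidef_fromBlocks`), trace
`(p₁ Tr B₁ + p₂ Tr B₂)/(p₁ + p₂) = 1`, and its `V`-block `p₁B₁/(p₁+p₂)` (resp. `W`-block)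
vanishes on `E(G)` (resp. `E(H)`) — there are no edges between the blocks.
[cite: Knuth1994, §18 (18.4)–(18.7)] -/
theorem isThetaFeasible_sumMatrix {G : SimpleGraph V} {H : SimpleGraph W} {B₁ : Matrix V V ℝ}
    {B₂ : Matrix W W ℝ} (h₁ : IsThetaFeasible G B₁) (h₂ : IsThetaFeasible H B₂)
    (hp : 0 < entrySum B₁ + entrySum B₂) : IsThetaFeasible (G ⊕g H) (sumMatrix B₁ B₂) where
  posSemidef := (posSemidef_fromBlocks h₁.posSemidef h₂.posSemidef).smul (inv_nonneg.2 hp.le)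
  trace_eq_one := by
    rw [sumMatrix, trace_smul, trace_sum_eq, submatrix_fromBlocks_inl, submatrix_fromBlocks_inr,
      trace_smul, trace_smul, h₁.trace_eq_one, h₂.trace_eq_one, smul_eq_mul, smul_eq_mul,
      smul_eq_mul, mul_one, mul_one, inv_mul_cancel₀ hp.ne']
  apply_eq_zero := by
    rintro (u | u) (v | v) huv
    · have huv' : G.Adj u v := SimpleGraph.sum_adj_inl.1 huv
      simp [sumMatrix, h₁.apply_eq_zero huv']
    · simp at huv
    · simp at huv
    · have huv' : H.Adj u v := SimpleGraph.sum_adj_inr.1 huv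
      simp [sumMatrix, h₂.apply_eq_zero huv']

/-- **The value of `sumMatrix B₁ B₂` is `p₁ + p₂`**:
`𝟙ᵀ[[p₁B₁, r₁r₂ᵀ],[r₂r₁ᵀ, p₂B₂]]𝟙 = p₁² + 2p₁p₂ + p₂² = (p₁+p₂)²` since `𝟙ᵀrᵢ = pᵢ`.
[cite: Knuth1994, §18 (18.2)] -/
theorem entrySum_sumMatrix {B₁ : Matrix V V ℝ} {B₂ : Matrix W W ℝ}
    (hp : 0 < entrySum B₁ + entrySum B₂) :
    entrySum (sumMatrix B₁ B₂) = entrySum B₁ + entrySum B₂ := by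
  obtain ⟨hc₁, hc₂⟩ := crossSum_fromBlocks (entrySum B₁ • B₁) (vecMulVec (B₁ *ᵥ 1) (B₂ *ᵥ 1))
    (vecMulVec (B₂ *ᵥ 1) (B₁ *ᵥ 1)) (entrySum B₂ • B₂)
  rw [sumMatrix, entrySum_smul, entrySum_sum_eq, submatrix_fromBlocks_inl,
    submatrix_fromBlocks_inr, hc₁, hc₂, entrySum_smul, entrySum_smul]
  simp only [vecMulVec_apply]
  rw [← Finset.sum_mul_sum, ← Finset.sum_mul_sum, sum_mulVec_one, sum_mulVec_one,
    inv_mul_eq_iff_eq_mul₀ hp.ne']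
  ring

/-- **Lemma 18, `≥`**: `Σ B₁ + Σ B₂ ≤ ϑ(G ⊕g H)` for feasible `B₁`, `B₂` (the value of
`sumMatrix B₁ B₂`; if both values vanish there is nothing to prove), hence
`ϑ(G) + ϑ(H) ≤ ϑ(G ⊕g H)`. [cite: Knuth1994, §18 Lemma (18.2)] -/
theorem add_le_lovaszTheta_sum [DecidableEq V] [DecidableEq W] [Nonempty V] [Nonempty W]
    (G : SimpleGraph V) (H : SimpleGraph W) :
    lovaszTheta G + lovaszTheta H ≤ lovaszTheta (G ⊕g H) := by
  have hne₁ : (entrySum '' {B | IsThetaFeasible G B}).Nonempty :=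
    ⟨_, _, isThetaFeasible_smul_one G, rfl⟩
  have hne₂ : (entrySum '' {B | IsThetaFeasible H B}).Nonempty :=
    ⟨_, _, isThetaFeasible_smul_one H, rfl⟩
  have key : ∀ {B₁ : Matrix V V ℝ} {B₂ : Matrix W W ℝ}, IsThetaFeasible G B₁ →
      IsThetaFeasible H B₂ → entrySum B₁ + entrySum B₂ ≤ lovaszTheta (G ⊕g H) := by
    intro B₁ B₂ h₁ h₂
    have hp₁ : 0 ≤ entrySum B₁ := by
      rw [entrySum_eq_one_dotProduct]
      have := h₁.posSemidef.dotProduct_mulVec_nonneg 1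
      rwa [star_trivial] at this
    have hp₂ : 0 ≤ entrySum B₂ := by
      rw [entrySum_eq_one_dotProduct]
      have := h₂.posSemidef.dotProduct_mulVec_nonneg 1
      rwa [star_trivial] at this
    rcases (add_nonneg hp₁ hp₂).eq_or_lt with hp | hp
    · rw [← hp]; exact lovaszTheta_nonneg _
    · rw [← entrySum_sumMatrix hp]
      exact le_csSup (bddAbove_thetaValues _) ⟨_, isThetaFeasible_sumMatrix h₁ h₂ hp, rfl⟩
  have step : ∀ {B₂ : Matrix W W ℝ}, IsThetaFeasible H B₂ →
      lovaszTheta G ≤ lovaszTheta (G ⊕g H) - entrySum B₂ := by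
    intro B₂ h₂
    refine csSup_le hne₁ ?_
    rintro _ ⟨B₁, h₁, rfl⟩
    linarith [key h₁ h₂]
  have : lovaszTheta H ≤ lovaszTheta (G ⊕g H) - lovaszTheta G := by
    refine csSup_le hne₂ ?_
    rintro _ ⟨B₂, h₂, rfl⟩
    linarith [step h₂]
  linarith

/-- **Knuth's Lemma 18 (18.2), unit weights: `ϑ(G ⊕g H) = ϑ(G) + ϑ(H)`** for the disjoint sum
of graphs on nonempty finite vertex types. [cite: Knuth1994, §18 Lemma (18.2)] -/
theorem lovaszTheta_sum [DecidableEq V] [DecidableEq W] [Nonempty V] [Nonempty W]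
    (G : SimpleGraph V) (H : SimpleGraph W) :
    lovaszTheta (G ⊕g H) = lovaszTheta G + lovaszTheta H :=
  le_antisymm (lovaszTheta_sum_le G H) (add_le_lovaszTheta_sum G H)

/-! ### Lemma 19: the direct cosum `(Gᶜ ⊕g Hᶜ)ᶜ` -/

/-- **Lemma 19, `≤`** (complement form): a feasible matrix `B` for `(G ⊕g H)ᶜ` vanishes between
the blocks (opposite vertices are adjacent in the complement of the sum) and its diagonal blocks
vanish on `E(Gᶜ)`, `E(Hᶜ)`, so `Σ B = Σ B₁₁ + Σ B₂₂ ≤ Tr B₁₁ ϑ(Gᶜ) + Tr B₂₂ ϑ(Hᶜ) ≤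
max(ϑ(Gᶜ), ϑ(Hᶜ))`. [cite: Knuth1994, §19 Lemma (19.2)] -/
theorem lovaszTheta_sum_compl_le [DecidableEq V] [DecidableEq W] (G : SimpleGraph V)
    (H : SimpleGraph W) : lovaszTheta (G ⊕g H)ᶜ ≤ max (lovaszTheta Gᶜ) (lovaszTheta Hᶜ) := by
  refine Real.sSup_le ?_ (le_max_of_le_left (lovaszTheta_nonneg _))
  rintro _ ⟨B, hB, rfl⟩
  set P := B.submatrix Sum.inl Sum.inl with hPdef
  set Q := B.submatrix Sum.inr Sum.inr with hQdef
  have hP : P.PosSemidef := hB.posSemidef.submatrix Sum.inl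
  have hQ : Q.PosSemidef := hB.posSemidef.submatrix Sum.inr
  have hPE : ∀ ⦃u v : V⦄, Gᶜ.Adj u v → P u v = 0 := fun u v huv =>
    hB.apply_eq_zero (by
      rw [SimpleGraph.compl_adj] at huv ⊢
      exact ⟨by simpa using huv.1, by simpa using huv.2⟩)
  have hQE : ∀ ⦃u v : W⦄, Hᶜ.Adj u v → Q u v = 0 := fun u v huv =>
    hB.apply_eq_zero (by
      rw [SimpleGraph.compl_adj] at huv ⊢
      exact ⟨by simpa using huv.1, by simpa using huv.2⟩)
  have hcross : ∀ (u : V) (w : W), B (Sum.inl u) (Sum.inr w) = 0 := fun u w =>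
    hB.apply_eq_zero (by rw [SimpleGraph.compl_adj]; exact ⟨by simp, by simp⟩)
  have hcross' : ∀ (w : W) (u : V), B (Sum.inr w) (Sum.inl u) = 0 := fun w u => by
    rw [apply_comm hB.posSemidef, hcross]
  have hps := entrySum_le_trace_mul_lovaszTheta hP hPE
  have hqs := entrySum_le_trace_mul_lovaszTheta hQ hQE
  have htt : P.trace + Q.trace = 1 := by rw [← trace_sum_eq B, hB.trace_eq_one]
  have ht := hP.trace_nonneg
  have ht' := hQ.trace_nonneg
  rw [entrySum_sum_eq B, ← hPdef, ← hQdef, crossSum]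
  simp only [hcross, hcross', sum_const_zero, add_zero]
  calc entrySum P + entrySum Q ≤ P.trace * lovaszTheta Gᶜ + Q.trace * lovaszTheta Hᶜ :=
        add_le_add hps hqs
    _ ≤ P.trace * max (lovaszTheta Gᶜ) (lovaszTheta Hᶜ) +
          Q.trace * max (lovaszTheta Gᶜ) (lovaszTheta Hᶜ) :=
        add_le_add (mul_le_mul_of_nonneg_left (le_max_left _ _) ht)
          (mul_le_mul_of_nonneg_left (le_max_right _ _) ht')
    _ = max (lovaszTheta Gᶜ) (lovaszTheta Hᶜ) := by rw [← add_mul, htt, one_mul]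

/-- Padding with zeros: if `B₁` is feasible for `Gᶜ` then `[[B₁, 0], [0, 0]]` is feasible for
`(G ⊕g H)ᶜ` (its only nonzero entries lie in the `V`-block, where `(G ⊕g H)ᶜ` restricts to
`Gᶜ`). [cite: Knuth1994, §19 (19.4) (the case v ∈ V')] -/
theorem isThetaFeasible_fromBlocks_zero {G : SimpleGraph V} (H : SimpleGraph W)
    {B₁ : Matrix V V ℝ} (h₁ : IsThetaFeasible Gᶜ B₁) :
    IsThetaFeasible (G ⊕g H)ᶜ (Matrix.fromBlocks B₁ 0 0 (0 : Matrix W W ℝ)) where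
  posSemidef := by
    refine PosSemidef.of_dotProduct_mulVec_nonneg
      (IsHermitian.fromBlocks h₁.posSemidef.1 (by simp) isHermitian_zero) fun x => ?_
    obtain ⟨y, z, rfl⟩ : ∃ (y : V → ℝ) (z : W → ℝ), x = Sum.elim y z :=
      ⟨x ∘ Sum.inl, x ∘ Sum.inr, (Sum.elim_comp_inl_inr x).symm⟩
    have hy := h₁.posSemidef.dotProduct_mulVec_nonneg y
    rw [star_trivial] at hy ⊢
    rw [fromBlocks_mulVec, Sum.elim_comp_inl, Sum.elim_comp_inr, sumElim_dotProduct_sumElim]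
    simpa using hy
  trace_eq_one := by
    rw [trace_sum_eq, submatrix_fromBlocks_inl, submatrix_fromBlocks_inr, trace_zero, add_zero,
      h₁.trace_eq_one]
  apply_eq_zero := by
    rintro (u | u) (v | v) huv
    · have huv' : Gᶜ.Adj u v := by
        rw [SimpleGraph.compl_adj] at huv ⊢
        exact ⟨fun h => huv.1 (by rw [h]), fun h => huv.2 (SimpleGraph.sum_adj_inl.2 h)⟩
      simp [h₁.apply_eq_zero huv']
    · simp
    · simp
    · simp

/-- **Lemma 19, `≥`, left summand**: `ϑ(Gᶜ) ≤ ϑ((G ⊕g H)ᶜ)` (pad a feasible matrix for `Gᶜ`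
with zeros). [cite: Knuth1994, §19 Lemma (19.2)] -/
theorem lovaszTheta_compl_le_sum_compl_left [DecidableEq V] [DecidableEq W] (G : SimpleGraph V)
    (H : SimpleGraph W) : lovaszTheta Gᶜ ≤ lovaszTheta (G ⊕g H)ᶜ := by
  by_cases hne : (entrySum '' {B | IsThetaFeasible Gᶜ B}).Nonempty
  · refine csSup_le hne ?_
    rintro _ ⟨B₁, h₁, rfl⟩
    have hval : entrySum (Matrix.fromBlocks B₁ 0 0 (0 : Matrix W W ℝ)) = entrySum B₁ := by
      obtain ⟨hc₁, hc₂⟩ := crossSum_fromBlocks B₁ 0 0 (0 : Matrix W W ℝ)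
      rw [entrySum_sum_eq, submatrix_fromBlocks_inl, submatrix_fromBlocks_inr, hc₁, hc₂]
      simp [entrySum]
    rw [← hval]
    exact le_csSup (bddAbove_thetaValues _) ⟨_, isThetaFeasible_fromBlocks_zero H h₁, rfl⟩
  · rw [Set.not_nonempty_iff_eq_empty] at hne
    rw [lovaszTheta, hne, Real.sSup_empty]
    exact lovaszTheta_nonneg _

/-- The complement of a sum is isomorphic to the complement of the swapped sum
(`Equiv.sumComm`). [folklore] -/
@[folklore] private def complSumCommIso (G : SimpleGraph V) (H : SimpleGraph W) :
    (G ⊕g H)ᶜ ≃g (H ⊕g G)ᶜ where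
  toEquiv := Equiv.sumComm V W
  map_rel_iff' := by
    rintro (u | u) (v | v) <;> simp [SimpleGraph.compl_adj]

/-- `ϑ((H ⊕g G)ᶜ) ≤ ϑ((G ⊕g H)ᶜ)`: transport feasible matrices along `complSumCommIso`
(`B ↦ B.submatrix swap swap`). [folklore] -/
@[folklore] private theorem lovaszTheta_sum_compl_comm [DecidableEq V] [DecidableEq W]
    (G : SimpleGraph V) (H : SimpleGraph W) :
    lovaszTheta (H ⊕g G)ᶜ ≤ lovaszTheta (G ⊕g H)ᶜ := by
  by_cases hne : (entrySum '' {B | IsThetaFeasible (H ⊕g G)ᶜ B}).Nonempty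
  · refine csSup_le hne ?_
    rintro _ ⟨B, hB, rfl⟩
    set φ := complSumCommIso G H
    have hfeas : IsThetaFeasible (G ⊕g H)ᶜ (B.submatrix φ φ) :=
      { posSemidef := hB.posSemidef.submatrix _
        trace_eq_one := by
          rw [← hB.trace_eq_one]
          simp only [Matrix.trace, Matrix.diag, submatrix_apply]
          exact φ.toEquiv.sum_comp (fun w => B w w)
        apply_eq_zero := fun u v huv => hB.apply_eq_zero (φ.map_adj_iff.2 huv) }
    have hval : entrySum (B.submatrix φ φ) = entrySum B := by
      unfold entrySum
      simp only [submatrix_apply]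
      exact Fintype.sum_equiv φ.toEquiv _ _ fun u =>
        Fintype.sum_equiv φ.toEquiv _ _ fun v => rfl
    rw [← hval]
    exact le_csSup (bddAbove_thetaValues _) ⟨_, hfeas, rfl⟩
  · rw [Set.not_nonempty_iff_eq_empty] at hne
    rw [lovaszTheta, hne, Real.sSup_empty]
    exact lovaszTheta_nonneg _

/-- **Knuth's Lemma 19 (19.2) in complement form: `ϑ((G ⊕g H)ᶜ) = max(ϑ(Gᶜ), ϑ(Hᶜ))`**
(unit weights). [cite: Knuth1994, §19 Lemma (19.2)] -/
theorem lovaszTheta_sum_compl [DecidableEq V] [DecidableEq W] (G : SimpleGraph V)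
    (H : SimpleGraph W) : lovaszTheta (G ⊕g H)ᶜ = max (lovaszTheta Gᶜ) (lovaszTheta Hᶜ) := by
  refine le_antisymm (lovaszTheta_sum_compl_le G H) (max_le ?_ ?_)
  · exact lovaszTheta_compl_le_sum_compl_left G H
  · exact (lovaszTheta_compl_le_sum_compl_left H G).trans (lovaszTheta_sum_compl_comm G H)

/-- **Knuth's Lemma 19 (19.2): `ϑ(G ∓ H) = max(ϑ(G), ϑ(H))`** for the direct cosum
`G ∓ H := (Gᶜ ⊕g Hᶜ)ᶜ` of (19.1) ("`u ∼ v` iff `u ∼ v` in `G'` or in `G''` or `u`, `v` belong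
to opposite vertex sets"). [cite: Knuth1994, §19 (19.1)–(19.2)] -/
theorem lovaszTheta_cosum [DecidableEq V] [DecidableEq W] (G : SimpleGraph V)
    (H : SimpleGraph W) : lovaszTheta (Gᶜ ⊕g Hᶜ)ᶜ = max (lovaszTheta G) (lovaszTheta H) := by
  rw [lovaszTheta_sum_compl, compl_compl, compl_compl]

/-! ### (23.1): `G = K̄_m + K_{n-m}` -/

/-- **(23.1), first half: `ϑ(K̄_{m+1} + K_{k+1}) = (m + 1) + 1`** (`= ϑ(K̄_{m+1}) + ϑ(K_{k+1})`
by Lemma 18, with `ϑ(K̄) = |K̄|` and `ϑ(K) = 1`). [cite: Knuth1994, §23 (23.1)] -/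
theorem lovaszTheta_bot_sum_top (m k : ℕ) :
    lovaszTheta ((⊥ : SimpleGraph (Fin (m + 1))) ⊕g (⊤ : SimpleGraph (Fin (k + 1)))) =
      (m + 1 : ℕ) + 1 := by
  rw [lovaszTheta_sum, lovaszTheta_bot, lovaszTheta_completeGraph, Fintype.card_fin]

/-- **(23.1), second half: `ϑ` of the complement `K_{m+1} ∓ K̄_{k+1}` is
`max(1, k + 1) = k + 1`** (Lemma 19). [cite: Knuth1994, §23 (23.1)] -/
theorem lovaszTheta_bot_sum_top_compl (m k : ℕ) :
    lovaszTheta ((⊥ : SimpleGraph (Fin (m + 1))) ⊕g (⊤ : SimpleGraph (Fin (k + 1))))ᶜ =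
      (k + 1 : ℕ) := by
  rw [lovaszTheta_sum_compl, compl_bot, compl_top, lovaszTheta_completeGraph, lovaszTheta_bot,
    Fintype.card_fin, max_eq_right]
  exact_mod_cast Nat.le_add_left 1 k

/-- The instance `n = 4`, `m = 2` of §23: for `G = K̄₂ + K₂` (a `4`-vertex graph),
`ϑ(G) · ϑ(Ḡ) = 3 · 2 = 6 = n²/4 + n/2 > n = 4` — so `ϑ(G)ϑ(Ḡ) = n` (true for the cycles,
§22) fails in general. [cite: Knuth1994, §23 (23.1) ("as high as n²/4 + n/2 when m = ⌊n/2⌋")] -/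
theorem lovaszTheta_mul_compl_bot_sum_top_two :
    lovaszTheta ((⊥ : SimpleGraph (Fin 2)) ⊕g (⊤ : SimpleGraph (Fin 2))) *
        lovaszTheta ((⊥ : SimpleGraph (Fin 2)) ⊕g (⊤ : SimpleGraph (Fin 2)))ᶜ = 6 := by
  rw [lovaszTheta_sum, lovaszTheta_bot, lovaszTheta_completeGraph, Fintype.card_fin,
    lovaszTheta_sum_compl, compl_bot, compl_top, lovaszTheta_completeGraph, lovaszTheta_bot,
    Fintype.card_fin, max_eq_right (by norm_num)]
  norm_num

end Literature.Combinatorics.SimpleGraph.LovaszThetaDirectSum
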